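import Summits.KontsevichZagierPeriods.Zeta5Search.WellPoisedInteriorForms
import HarnessLib

/-!
# `ζ(5)` search — the INTERIOR of Zudilin's `ζ(5)`-only well-poised box, file 2 of 2: the kernel no-go REDUCTION
(cell `pub-zeta5`, class vwp, fam-vwp gen 62–63; families/vwp/FAMILY.md §13, §28, §70–§71)

Setting and typed objects (`genF`, `genPhi`, `genLambda`, `genM`, `genDelta`): file 1 of 2, `WellPoisedInteriorForms`
([Zudilin2004 = arXiv:math/0206176] §8, `r = 3`, `q = 7`; `h₀ = η₀n + 2`, `h_j = η_j n + 1`, `2η₇ < η₀`).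

Contents (every statement kernel-checked, standard axioms; no `sorry`):
* §I4 THE REDUCTION `interior_noGo_of_rates`: for an admissible direction and real `C, φ⁺` with `C + φ⁺ < δ`,
  IF `|F(h_n)| ≥ e^{−Cn}` for infinitely many `n` (Lemma 20 — `lim sup (1/n) log |F(h_n)| = Re f₀(τ₀) =: −C₀` under
  its side conditions `Re τ₀ < η₀`, `Im f₀(τ₀) ∉ πℤ` — gives this for every `C > C₀`;
  PRINTED + certified constants) and `Φ(h_n) ≤ e^{φ⁺ n}` eventually ((Φ-rate): `(1/n) log Φ(h_n) → ∫₀¹ φ dψ −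
  ∫₀^{1/m₄} φ dx/x²` [Zudilin2004 §8, from (8.9) and (8.13), the display before Proposition 5], PRINTED; or file 1's
  `genPhi_eventually_le`, kernel but crude), THEN `|Λ_n| ≥ e^{εn}` infinitely often, `ε = (δ − C − φ⁺)/2 > 0`; hence
  `|Λ_n| ≥ 1` infinitely often, `Λ_n ↛ 0`, and `|Λ_n|` is unbounded.  With Lemma 19 [PRINTED] `Λ_n ∈ ℤζ(5) + ℤ`,
  Proposition 5's hypothesis (`0 < |Λ_n| → 0`) fails at that direction.  Inputs: PNT for `ψ` (tree theorem, via
  face file 5's `tendsto_psi_mul_div`), `D_N = e^{ψ(N)}` (`psi_eq_log_lcmUpto`).  `interior_noGo` is the same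
  statement in the shape of the certified table (`hL20`, `hPhiRate`, `C₀ + φ < δ`).
* §I5 CONSISTENCY WITH THE FACE: at `ηp = 0` the hypotheses of §I4 are kernel theorems (face files 4, 5), and the
  reduction re-derives `|Λ_n| ≥ 1` infinitely often on every sorted face direction (`face_frequently_one_le`).
On the (Φ-rate) hypothesis: the no-go direction uses only the UPPER rate `lim sup (1/n) log Φ(h_n) ≤ φ`.  Zudilin
proves `ν_p ≥ φ(n/p)` (a lower bound, for his positive result); fam-vwp gen 63 checked by exact piece arithmetic
that his real-variable minimum `φ(x) = min_y φ₀(x,y)` coincides with the minimum over the ADMISSIBLE residues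
`y = (k−1)/p`, `h₄ ≤ k ≤ h₀ − h₄`, on every piece and every direction of the certified box `8 ≤ η₀ ≤ 30` (and on the
face box `η₀ ≤ 60`), the primes `p ∣ η₀n + 1` excepted (they carry `O(log n)`); so the tabulated `φ` IS the upper
rate the reduction consumes (FAMILY.md §71; MODEL-level check, not a kernel statement).
What is NOT formalised: Lemma 20 (the saddle-point asymptotics of `F(h_n)` in the interior — a 7-parameter
family with complex saddles; research-level), the (Φ-rate), and Lemma 19's membership `Λ_n ∈ ℤζ(5)+ℤ` with the
pairs ON (on the face, `ηp = 0`, that membership IS kernel: `WellPoisedFacePhi.faceLambda_mem`, fam-vwp gen 7).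
HONEST FRAMING: systematic search; no irrationality claim unless certified.  SCOREBOARD reading of this file:
the class-vwp interior = "kernel REDUCTION (this file) + Lemma 20 / (Φ-rate) PRINTED + constants certified-MODEL
for `η₀ ≤ 30` (sup κ 0.4172 < 1; lane job ids in SUPKAPPA7.md)"; the pointwise statement at unbounded height is a
MODEL extrapolation (face value 0.4972), FAMILY.md §28.
-/

noncomputable section

open Real Filter Topology Finset

namespace Summit.KontsevichZagierPeriods.Zeta5Search.WellPoisedInterior

open Summit.KontsevichZagierPeriods.Zeta5Search.WellPoisedFace
open Summit.KontsevichZagierPeriods.Zeta5Search.WellPoisedFaceRate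
open Chebyshev

/-! ### §I4 THE REDUCTION: decay rate + `Φ`-rate + `C + φ⁺ < δ` ⟹ the normalised forms do not tend to `0` -/

/-- PNT for the `D`-product: `(3ψ(nm₁) + ψ(nm₂) + ψ(nm₃) + ψ(nm₄))/n → δ`. -/
theorem tendsto_psiSum_div (η₀ : ℕ) (ηp : Fin 3 → ℕ) (ηb : Fin 4 → ℕ) (hb : ∀ j, 2 * ηb j < η₀) :
    Tendsto (fun n : ℕ => (3 * ψ ((n * genM η₀ ηp ηb 0 : ℕ) : ℝ) + ψ ((n * genM η₀ ηp ηb 1 : ℕ) : ℝ)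
        + ψ ((n * genM η₀ ηp ηb 2 : ℕ) : ℝ) + ψ ((n * genM η₀ ηp ηb 3 : ℕ) : ℝ)) / n) atTop
      (𝓝 (genDelta η₀ ηp ηb : ℝ)) := by
  have h0 := tendsto_psi_mul_div (genM_pos η₀ ηp ηb hb 0)
  have h1 := tendsto_psi_mul_div (genM_pos η₀ ηp ηb hb 1)
  have h2 := tendsto_psi_mul_div (genM_pos η₀ ηp ηb hb 2)
  have h3 := tendsto_psi_mul_div (genM_pos η₀ ηp ηb hb 3)
  have hsum := (((h0.const_mul 3).add h1).add h2).add h3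
  have key : (fun n : ℕ => (3 * ψ ((n * genM η₀ ηp ηb 0 : ℕ) : ℝ) + ψ ((n * genM η₀ ηp ηb 1 : ℕ) : ℝ)
        + ψ ((n * genM η₀ ηp ηb 2 : ℕ) : ℝ) + ψ ((n * genM η₀ ηp ηb 3 : ℕ) : ℝ)) / n)
      = fun n : ℕ => 3 * (ψ ((n * genM η₀ ηp ηb 0 : ℕ) : ℝ) / n) + ψ ((n * genM η₀ ηp ηb 1 : ℕ) : ℝ) / n
        + ψ ((n * genM η₀ ηp ηb 2 : ℕ) : ℝ) / n + ψ ((n * genM η₀ ηp ηb 3 : ℕ) : ℝ) / n := by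
    funext n; ring
  have hv : (genDelta η₀ ηp ηb : ℝ)
      = 3 * (genM η₀ ηp ηb 0 : ℝ) + genM η₀ ηp ηb 1 + genM η₀ ηp ηb 2 + genM η₀ ηp ηb 3 := by
    simp only [genDelta]; push_cast; ring
  rw [key, hv]
  exact hsum

/-- Eventually `3ψ(nm₁) + ψ(nm₂) + ψ(nm₃) + ψ(nm₄) ≥ (δ − ε)·n`. -/
theorem psiSum_eventually_ge (η₀ : ℕ) (ηp : Fin 3 → ℕ) (ηb : Fin 4 → ℕ) (hb : ∀ j, 2 * ηb j < η₀)
    (ε : ℝ) (hε : 0 < ε) :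
    ∀ᶠ n : ℕ in atTop, ((genDelta η₀ ηp ηb : ℝ) - ε) * n
      ≤ 3 * ψ ((n * genM η₀ ηp ηb 0 : ℕ) : ℝ) + ψ ((n * genM η₀ ηp ηb 1 : ℕ) : ℝ)
        + ψ ((n * genM η₀ ηp ηb 2 : ℕ) : ℝ) + ψ ((n * genM η₀ ηp ηb 3 : ℕ) : ℝ) := by
  have hT := tendsto_psiSum_div η₀ ηp ηb hb
  have hev := hT.eventually (Ioi_mem_nhds (show (genDelta η₀ ηp ηb : ℝ) - ε < genDelta η₀ ηp ηb by linarith))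
  filter_upwards [hev, eventually_ge_atTop 1] with n hn hn1
  have hnpos : (0 : ℝ) < n := by exact_mod_cast hn1
  have hn' : (genDelta η₀ ηp ηb : ℝ) - ε < (3 * ψ ((n * genM η₀ ηp ηb 0 : ℕ) : ℝ)
      + ψ ((n * genM η₀ ηp ηb 1 : ℕ) : ℝ) + ψ ((n * genM η₀ ηp ηb 2 : ℕ) : ℝ)
      + ψ ((n * genM η₀ ηp ηb 3 : ℕ) : ℝ)) / n := hn
  rw [lt_div_iff₀ hnpos] at hn'
  linarith

/-- **THE INTERIOR NO-GO REDUCTION (kernel).**  Let `(η₀; ηp, ηb)` be admissible (`η_i ≤ η₄` for the pairs,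
`2η_j < η₀` for the bricks) and `C, φ⁺` real with `C + φ⁺ < δ`.  IF `|F(h_n)| ≥ e^{−Cn}` for infinitely many `n`
— this is what Lemma 20 [Zudilin2004, PRINTED: `lim sup (1/n) log |F(h_n)| = Re f₀(τ₀) =: −C₀`, under the side
conditions `Re τ₀ < η₀`, `Im f₀(τ₀) ∉ πℤ`] gives for every `C > C₀`, the constant `C₀` (and the side conditions)
being certified direction by direction by the compute lane — and `Φ(h_n) ≤ e^{φ⁺n}` for all large `n`
— (Φ-rate) [PRINTED], or `genPhi_eventually_le` (kernel, crude) — THEN `|Λ_n| ≥ e^{εn}` for infinitely many `n`,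
`ε = (δ − C − φ⁺)/2 > 0`.  Everything else (the `D`-product via the prime number theorem, `Φ ≥ 1`, the algebra) is
proved here.  With Lemma 19 (`Λ_n ∈ ℤζ(5) + ℤ`; PRINTED with pairs on) this says: Proposition 5 / the Nesterenko
criterion get no input from this direction.  Systematic search; no irrationality claim. -/
theorem interior_noGo_of_rates (η₀ : ℕ) (ηp : Fin 3 → ℕ) (ηb : Fin 4 → ℕ) (hpb : ∀ i, ηp i ≤ ηb 0)
    (hb : ∀ j, 2 * ηb j < η₀) {C φp : ℝ} (hgap : C + φp < (genDelta η₀ ηp ηb : ℝ))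
    (hdecay : ∃ᶠ n : ℕ in atTop, Real.exp (-(C * n)) ≤ |genF η₀ ηp ηb n|)
    (hphi : ∀ᶠ n : ℕ in atTop, (genPhi η₀ ηp ηb n : ℝ) ≤ Real.exp (φp * n)) :
    ∃ᶠ n : ℕ in atTop,
      Real.exp (((genDelta η₀ ηp ηb : ℝ) - C - φp) / 2 * n) ≤ |genLambda η₀ ηp ηb n| := by
  set ε : ℝ := ((genDelta η₀ ηp ηb : ℝ) - C - φp) / 2 with hε
  have hεpos : 0 < ε := by rw [hε]; linarith
  have hS := psiSum_eventually_ge η₀ ηp ηb hb ε hεpos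
  refine (hdecay.and_eventually (hphi.and hS)).mono ?_
  rintro n ⟨hF, hΦ, hSn⟩
  have hΦpos : (0 : ℝ) < genPhi η₀ ηp ηb n := by exact_mod_cast genPhi_pos η₀ ηp ηb n
  set S : ℝ := 3 * ψ ((n * genM η₀ ηp ηb 0 : ℕ) : ℝ) + ψ ((n * genM η₀ ηp ηb 1 : ℕ) : ℝ)
      + ψ ((n * genM η₀ ηp ηb 2 : ℕ) : ℝ) + ψ ((n * genM η₀ ηp ηb 3 : ℕ) : ℝ) with hSdef
  have e : ((genDelta η₀ ηp ηb : ℝ) - ε) * n - φp * n - C * n = ε * n := by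
    rw [hε]; ring
  rw [abs_genLambda_eq η₀ ηp ηb hpb hb n]
  calc Real.exp (ε * n) ≤ Real.exp (S - φp * n - C * n) := Real.exp_le_exp.2 (by linarith)
    _ = Real.exp S / Real.exp (φp * n) * Real.exp (-(C * n)) := by
        rw [sub_eq_add_neg, Real.exp_add, Real.exp_sub]
    _ ≤ Real.exp S / (genPhi η₀ ηp ηb n : ℝ) * |genF η₀ ηp ηb n| := by
        apply mul_le_mul _ hF (Real.exp_pos _).le
          (div_nonneg (Real.exp_pos _).le hΦpos.le)
        exact div_le_div_of_nonneg_left (Real.exp_pos _).le hΦpos hΦ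

/-- Corollary: `|Λ_n| ≥ 1` for infinitely many `n`. -/
theorem interior_frequently_one_le (η₀ : ℕ) (ηp : Fin 3 → ℕ) (ηb : Fin 4 → ℕ) (hpb : ∀ i, ηp i ≤ ηb 0)
    (hb : ∀ j, 2 * ηb j < η₀) {C φp : ℝ} (hgap : C + φp < (genDelta η₀ ηp ηb : ℝ))
    (hdecay : ∃ᶠ n : ℕ in atTop, Real.exp (-(C * n)) ≤ |genF η₀ ηp ηb n|)
    (hphi : ∀ᶠ n : ℕ in atTop, (genPhi η₀ ηp ηb n : ℝ) ≤ Real.exp (φp * n)) :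
    ∃ᶠ n : ℕ in atTop, 1 ≤ |genLambda η₀ ηp ηb n| := by
  have hεpos : 0 < ((genDelta η₀ ηp ηb : ℝ) - C - φp) / 2 := by linarith
  refine (interior_noGo_of_rates η₀ ηp ηb hpb hb hgap hdecay hphi).mono fun n hn => le_trans ?_ hn
  exact Real.one_le_exp (by positivity)

/-- Corollary: `|Λ_n|` is unbounded (`|Λ_n| ≥ K` infinitely often, for every `K`). -/
theorem interior_frequently_ge (η₀ : ℕ) (ηp : Fin 3 → ℕ) (ηb : Fin 4 → ℕ) (hpb : ∀ i, ηp i ≤ ηb 0)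
    (hb : ∀ j, 2 * ηb j < η₀) {C φp : ℝ} (hgap : C + φp < (genDelta η₀ ηp ηb : ℝ))
    (hdecay : ∃ᶠ n : ℕ in atTop, Real.exp (-(C * n)) ≤ |genF η₀ ηp ηb n|)
    (hphi : ∀ᶠ n : ℕ in atTop, (genPhi η₀ ηp ηb n : ℝ) ≤ Real.exp (φp * n)) (K : ℝ) :
    ∃ᶠ n : ℕ in atTop, K ≤ |genLambda η₀ ηp ηb n| := by
  have hεpos : 0 < ((genDelta η₀ ηp ηb : ℝ) - C - φp) / 2 := by linarith
  have hexp : Tendsto (fun n : ℕ => Real.exp (((genDelta η₀ ηp ηb : ℝ) - C - φp) / 2 * n)) atTop atTop :=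
    Real.tendsto_exp_atTop.comp ((tendsto_natCast_atTop_atTop).const_mul_atTop hεpos)
  have hK := hexp.eventually (eventually_ge_atTop K)
  refine ((interior_noGo_of_rates η₀ ηp ηb hpb hb hgap hdecay hphi).and_eventually hK).mono ?_
  rintro n ⟨hn, hKn⟩
  exact le_trans hKn hn

/-- **Corollary: the normalised forms do NOT tend to `0`** — so `0 < |Λ_n| → 0`, the hypothesis of
Proposition 5 / Nesterenko's criterion for these forms, fails at the direction. -/
theorem interior_not_tendsto_zero (η₀ : ℕ) (ηp : Fin 3 → ℕ) (ηb : Fin 4 → ℕ) (hpb : ∀ i, ηp i ≤ ηb 0)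
    (hb : ∀ j, 2 * ηb j < η₀) {C φp : ℝ} (hgap : C + φp < (genDelta η₀ ηp ηb : ℝ))
    (hdecay : ∃ᶠ n : ℕ in atTop, Real.exp (-(C * n)) ≤ |genF η₀ ηp ηb n|)
    (hphi : ∀ᶠ n : ℕ in atTop, (genPhi η₀ ηp ηb n : ℝ) ≤ Real.exp (φp * n)) :
    ¬ Tendsto (genLambda η₀ ηp ηb) atTop (𝓝 0) := by
  intro h
  have h1 : ∀ᶠ n : ℕ in atTop, |genLambda η₀ ηp ηb n| < 1 := by
    have h' : Tendsto (fun n => |genLambda η₀ ηp ηb n|) atTop (𝓝 0) := by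
      simpa using h.abs
    exact h'.eventually (Iio_mem_nhds one_pos)
  obtain ⟨n, hn1, hn2⟩ :=
    ((interior_frequently_one_le η₀ ηp ηb hpb hb hgap hdecay hphi).and_eventually h1).exists
  linarith

/-- The same reduction with the decay hypothesis in LOGARITHMIC form (`log |F(h_n)| ≥ −Cn` infinitely often,
as Lemma 20 states it: `lim sup (1/n) log |F(h_n)| = −C₀`, so any `C > C₀` will do). -/
theorem interior_not_tendsto_zero_of_log (η₀ : ℕ) (ηp : Fin 3 → ℕ) (ηb : Fin 4 → ℕ)
    (hpb : ∀ i, ηp i ≤ ηb 0) (hb : ∀ j, 2 * ηb j < η₀) {C φp : ℝ}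
    (hgap : C + φp < (genDelta η₀ ηp ηb : ℝ))
    (hdecay : ∃ᶠ n : ℕ in atTop, genF η₀ ηp ηb n ≠ 0 ∧ -(C * n) ≤ Real.log |genF η₀ ηp ηb n|)
    (hphi : ∀ᶠ n : ℕ in atTop, Real.log (genPhi η₀ ηp ηb n) ≤ φp * n) :
    ¬ Tendsto (genLambda η₀ ηp ηb) atTop (𝓝 0) := by
  refine interior_not_tendsto_zero η₀ ηp ηb hpb hb hgap ?_ ?_
  · refine hdecay.mono ?_
    rintro n ⟨hne, hlog⟩
    have hpos : 0 < |genF η₀ ηp ηb n| := abs_pos.2 hne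
    calc Real.exp (-(C * n)) ≤ Real.exp (Real.log |genF η₀ ηp ηb n|) := Real.exp_le_exp.2 hlog
      _ = |genF η₀ ηp ηb n| := Real.exp_log hpos
  · filter_upwards [hphi] with n hn
    have hpos : (0 : ℝ) < genPhi η₀ ηp ηb n := by exact_mod_cast genPhi_pos η₀ ηp ηb n
    calc (genPhi η₀ ηp ηb n : ℝ) = Real.exp (Real.log (genPhi η₀ ηp ηb n)) := (Real.exp_log hpos).symm
      _ ≤ Real.exp (φp * n) := Real.exp_le_exp.2 hn

/-- **THE INTERIOR NO-GO IN THE SHAPE OF THE CERTIFIED TABLE.**  The compute lane tabulates, per admissible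
direction, Zudilin's two printed constants: `C₀ = −lim sup (1/n) log |F(h_n)|` (Lemma 20) and
`φ = lim (1/n) log Φ(h_n)` ((Φ-rate); `δ − φ` is Proposition 5's `C₂`), and `κ := C₀/(δ − φ) = C₀/C₂`.  Read as
hypotheses about the typed objects of this file — `hL20`: for every `C > C₀`, `|F(h_n)| ≥ e^{−Cn}` (and `≠ 0`)
for infinitely many `n`; `hPhiRate`: for every
`φ' > φ`, eventually `log Φ(h_n) ≤ φ'n` — the table's inequality `C₀ + φ < δ` (equivalently `κ < 1` when `φ < δ`)
yields, inside the kernel, that the Lemma-19-normalised forms do not tend to `0`.  Certified-MODEL status of the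
constants (exhaustive `8 ≤ η₀ ≤ 30`: `max κ = 0.4172`, i.e. `C₀ + φ < δ` with margin `≥ 0.58(δ − φ)`):
`run/shared/lean/ttrl/zeta5-calc/vwp/SUPKAPPA7.md`.  Systematic search; no irrationality claim. -/
theorem interior_noGo (η₀ : ℕ) (ηp : Fin 3 → ℕ) (ηb : Fin 4 → ℕ) (hpb : ∀ i, ηp i ≤ ηb 0)
    (hb : ∀ j, 2 * ηb j < η₀) (C0 φ0 : ℝ) (hκ : C0 + φ0 < (genDelta η₀ ηp ηb : ℝ))
    (hL20 : ∀ C : ℝ, C0 < C →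
      ∃ᶠ n : ℕ in atTop, genF η₀ ηp ηb n ≠ 0 ∧ -(C * n) ≤ Real.log |genF η₀ ηp ηb n|)
    (hPhiRate : ∀ φ' : ℝ, φ0 < φ' → ∀ᶠ n : ℕ in atTop, Real.log (genPhi η₀ ηp ηb n) ≤ φ' * n) :
    ¬ Tendsto (genLambda η₀ ηp ηb) atTop (𝓝 0) := by
  set e : ℝ := ((genDelta η₀ ηp ηb : ℝ) - C0 - φ0) / 3 with he
  have hepos : 0 < e := by rw [he]; linarith
  have hgap : (C0 + e) + (φ0 + e) < (genDelta η₀ ηp ηb : ℝ) := by rw [he]; linarith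
  exact interior_not_tendsto_zero_of_log η₀ ηp ηb hpb hb hgap (hL20 (C0 + e) (by linarith))
    (hPhiRate (φ0 + e) (by linarith))

/-! ### §I5 Consistency with the face: at `ηp = 0` both rate hypotheses are kernel theorems (files 4, 5) -/

/-- `δ` at `ηp = 0` is the `FaceDir.delta` of file 1 (through file 5's `faceM_cast`). -/
theorem genDelta_face (η₀ : ℕ) (η : Fin 4 → ℕ) (h01 : η 0 ≤ η 1) (h12 : η 1 ≤ η 2) (h23 : η 2 ≤ η 3)
    (h3 : 2 * η 3 < η₀) :
    (genDelta η₀ 0 η : ℝ) = (faceDirOfNat η₀ η h01 h12 h23 h3).delta := by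
  simp only [genDelta, genM_face]
  push_cast
  rw [faceM_cast η₀ η h01 h12 h23 h3 0, faceM_cast η₀ η h01 h12 h23 h3 1, faceM_cast η₀ η h01 h12 h23 h3 2,
    faceM_cast η₀ η h01 h12 h23 h3 3]
  simp only [FaceDir.delta, FaceDir.m1, FaceDir.m2, FaceDir.m3, FaceDir.m4]
  rfl

/-- `3·m₄` at `ηp = 0` is `FaceDir.phiBound`. -/
theorem phiBound_face (η₀ : ℕ) (η : Fin 4 → ℕ) (h01 : η 0 ≤ η 1) (h12 : η 1 ≤ η 2) (h23 : η 2 ≤ η 3)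
    (h3 : 2 * η 3 < η₀) :
    3 * (faceM η₀ η 3 : ℝ) = (faceDirOfNat η₀ η h01 h12 h23 h3).phiBound := by
  rw [faceM_cast η₀ η h01 h12 h23 h3 3]
  simp only [FaceDir.phiBound, FaceDir.m4]
  rfl

/-- ON THE FACE THE REDUCTION IS UNCONDITIONAL: for every sorted face direction `(η₀; 0,0,0, η₄ ≤ ⋯ ≤ η₇)`,
`2η₇ < η₀`, the hypotheses of `interior_noGo_of_rates` are theorems of files 4–5 (`tendsto_log_faceF_div`,
`log_facePhi_eventually_le`, `net_exponent_pos`), so `|Λ_n| ≥ 1` infinitely often — a weak form of file 5's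
`faceLambda_tendsto_atTop`, re-derived through the interior machinery as a consistency check. -/
theorem face_frequently_one_le (η₀ : ℕ) (η : Fin 4 → ℕ) (h01 : η 0 ≤ η 1) (h12 : η 1 ≤ η 2)
    (h23 : η 2 ≤ η 3) (h3 : 2 * η 3 < η₀) :
    ∃ᶠ n : ℕ in atTop, 1 ≤ |faceLambda η₀ η n| := by
  have hη := two_mul_lt_of_sorted η₀ η h01 h12 h23 h3
  set D := faceDirOfNat η₀ η h01 h12 h23 h3 with hD
  have hpos := net_exponent_pos η₀ η h01 h12 h23 h3
  set e : ℝ := (D.delta - D.phiBound - D.C0) / 3 with he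
  have hepos : 0 < e := by rw [he]; exact div_pos hpos (by norm_num)
  have hpb : ∀ i, (0 : Fin 3 → ℕ) i ≤ η 0 := fun i => Nat.zero_le _
  -- the gap `C + φ⁺ < δ` with `C = C0 + e`, `φ⁺ = 3m₄ + e`
  have hgap : (D.C0 + e) + (3 * (faceM η₀ η 3 : ℝ) + e) < (genDelta η₀ 0 η : ℝ) := by
    rw [genDelta_face η₀ η h01 h12 h23 h3, phiBound_face η₀ η h01 h12 h23 h3]
    have : 2 * e < D.delta - D.phiBound - D.C0 := by rw [he]; linarith
    linarith
  -- decay: `log F_n / n → −C0` (file 4), so eventually `F_n ≥ exp(−(C0+e)n)`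
  have hT : Tendsto (fun n : ℕ => Real.log (faceF η₀ η n) / n) atTop (𝓝 (-D.C0)) := by
    rw [hD, C0_faceDirOfNat]
    exact tendsto_log_faceF_div η₀ η hη
  have hdecay : ∃ᶠ n : ℕ in atTop, Real.exp (-((D.C0 + e) * n)) ≤ |genF η₀ 0 η n| := by
    apply Eventually.frequently
    have hev := hT.eventually (Ioi_mem_nhds (show -D.C0 - e < -D.C0 by linarith))
    filter_upwards [hev, eventually_ge_atTop 1] with n hn hn1
    have hnpos : (0 : ℝ) < n := by exact_mod_cast hn1
    have hF : 0 < faceF η₀ η n := faceF_pos η₀ η hη n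
    have hn' : -D.C0 - e < Real.log (faceF η₀ η n) / n := hn
    rw [lt_div_iff₀ hnpos] at hn'
    rw [genF_face, abs_of_pos hF]
    calc Real.exp (-((D.C0 + e) * n)) ≤ Real.exp (Real.log (faceF η₀ η n)) :=
          Real.exp_le_exp.2 (by linarith)
      _ = faceF η₀ η n := Real.exp_log hF
  -- Φ-rate: file 5's `log_facePhi_eventually_le`
  have hphi : ∀ᶠ n : ℕ in atTop, (genPhi η₀ 0 η n : ℝ) ≤ Real.exp ((3 * (faceM η₀ η 3 : ℝ) + e) * n) := by
    filter_upwards [log_facePhi_eventually_le η₀ η hη e hepos] with n hn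
    have hΦ : (0 : ℝ) < facePhi η₀ η n := by exact_mod_cast facePhi_pos η₀ η n
    rw [genPhi_face]
    calc (facePhi η₀ η n : ℝ) = Real.exp (Real.log (facePhi η₀ η n)) := (Real.exp_log hΦ).symm
      _ ≤ Real.exp ((3 * (faceM η₀ η 3 : ℝ) + e) * n) := Real.exp_le_exp.2 hn
  have h := interior_frequently_one_le η₀ 0 η hpb hη hgap hdecay hphi
  refine h.mono fun n hn => ?_
  rwa [genLambda_face] at hn

end Summit.KontsevichZagierPeriods.Zeta5Search.WellPoisedInterior
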